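import Mathlib
import Summits.Ventures.PercRepro2.TypedResidualCore
import Summits.Ventures.PercRepro2.TypedSwapRoots
import Summits.Ventures.PercRepro2.RootCutTheorem

/-!
# The root-cut class at either root, subtracted from the core (blind cell PercRepro2, p2 g2,
2026-08-25; sub-claim S1, `proofs/subclaims/S1-REDUCTION.md`; the lead's ASSIGNMENTS v12.61
«p2 g1 (A)»)

Sub-claim S2.c (p3 g0, `RootCutTheorem.lean`) proves row 2′TRI at `z ≡ false` when the root `a₁`
is a cut vertex of the typed graph `(V, F)` separating `{o, b}` from `{a₂, a₃}`
(`RootBridge.HasCutAtRoot ends o a₁ a₂ a₃ b F`, `RootBridge.typedCount_nonneg_of_hasCutAtRoot`).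
The typed bases are symmetric in the roots (night-3's `SwapRoots.typedCount_swap_roots`), so the
MIRROR class — `a₂` a cut vertex separating `{o, b}` from `{a₁, a₃}`, i.e.
`RootBridge.HasCutAtRoot ends o a₂ a₁ a₃ b F` — is a theorem too.

* **`HasRootCut`** — the union of the two classes; **`typedCount_nonneg_of_hasRootCut`** — row 2′TRI
  on it (`z ≡ false`, mixed types);
* **`ResidualCoreC`** — the core (`ResidualCore`, TypedResidualCore.lean) with NO root cut at either
  root; **`HCov_all_of_residualCoreC_all : ResidualCoreC_all R → HCov_all R`** — UNCONDITIONAL: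
  the crux of record from (TRI) on the core instances without a root cut.

Own code; standard axioms.
-/

namespace Summit.Ventures.PercRepro2

open UnionCluster

namespace CovForm

namespace TypedRed

/-! ## The root-cut class at either root -/

section Cut

variable {V : Type*} {E : Type*} [Fintype E] [DecidableEq E]
variable {R : Type*} [Field R] [LinearOrder R] [IsStrictOrderedRing R]

/-- **The root-cut class**: `a₁` is a cut vertex of the typed graph `(V, F)` separating `{o, b}`
from `{a₂, a₃}`, or `a₂` is a cut vertex separating `{o, b}` from `{a₁, a₃}` (p3's
`RootBridge.HasCutAtRoot` at `a₁`, and its `a₂`-mirror). -/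
def HasRootCut (ends : E → Sym2 V) (o a₁ a₂ a₃ b : V) (F : Finset E) : Prop :=
  RootBridge.HasCutAtRoot ends o a₁ a₂ a₃ b F ∨ RootBridge.HasCutAtRoot ends o a₂ a₁ a₃ b F

/-- **Row 2′TRI on the root-cut class at `z ≡ false`**: at `a₁` this is p3's
`typedCount_nonneg_of_hasCutAtRoot`; at `a₂` the same theorem with the roots exchanged, carried
back by the root symmetry `typedCount_swap_roots`. -/
theorem typedCount_nonneg_of_hasRootCut (ends : E → Sym2 V) (o a₁ a₂ a₃ b : V) (F : Finset E)
    (τ : E → ℕ) (hτ : ∀ e ∈ F, τ e = 1 ∨ τ e = 2) (h : HasRootCut ends o a₁ a₂ a₃ b F) :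
    0 ≤ typedCount F (fun _ => false) τ
      (K3 ends o a₁ a₂ a₃ b : Config E → Config E → Config E → R) := by
  rcases h with h | h
  · exact RootBridge.typedCount_nonneg_of_hasCutAtRoot ends o a₁ a₂ a₃ b F τ hτ h
  · rw [← SwapRoots.typedCount_swap_roots ends o a₁ a₂ a₃ b F (fun _ => false) τ]
    exact RootBridge.typedCount_nonneg_of_hasCutAtRoot ends o a₂ a₁ a₃ b F τ hτ h

end Cut

/-! ## The conjunct in the core -/

section Core

variable {V : Type*} {E : Type*} [DecidableEq V] [Fintype E] [DecidableEq E]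

/-- **The core without a root cut**: `ResidualCore` (fully reduced, `|F| ≥ 6`, `a₁, a₂, o, b` of
typed degree `≥ 1`, `a₁ ↔ a₂` in `(V, F)`, every typed edge in the root component, no same-side
root bridge at `a₁`, `MarksDistinct`) and neither root is a cut vertex of `(V, F)` separating
`{o, b}` from the other root together with `a₃`. -/
structure ResidualCoreC (ends : E → Sym2 V) (o a₁ a₂ a₃ b : V) (F : Finset E) : Prop where
  core : ResidualCore ends o a₁ a₂ a₃ b F
  no_cut : ¬ HasRootCut ends o a₁ a₂ a₃ b F

end Core

section Closure

variable (R : Type*) [Field R] [LinearOrder R] [IsStrictOrderedRing R]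

/-- **Row 2′TRI on `ResidualCoreC`, over every finite graph.** -/
def ResidualCoreC_all : Prop :=
  ∀ (V E : Type) [Fintype V] [DecidableEq V] [Fintype E] [DecidableEq E]
    (ends : E → Sym2 V) (o a₁ a₂ a₃ b : V) (F : Finset E) (τ : E → ℕ),
    (∀ e ∈ F, τ e = 1 ∨ τ e = 2) → ResidualCoreC ends o a₁ a₂ a₃ b F →
      0 ≤ typedCount F (fun _ => false) τ
        (K3 ends o a₁ a₂ a₃ b : Config E → Config E → Config E → R)

/-- **THE CRUX OF RECORD FROM (TRI) ON THE CORE WITHOUT A ROOT CUT** (unconditional): the core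
instances with a root cut at `a₁` or at `a₂` are the theorem `typedCount_nonneg_of_hasRootCut`. -/
theorem HCov_all_of_residualCoreC_all (hc : ResidualCoreC_all R) : HCov_all R := by
  refine HCov_all_of_residualCore_all R ?_
  intro V E _ _ _ _ ends o a₁ a₂ a₃ b F τ hτ hcore
  by_cases hcut : HasRootCut ends o a₁ a₂ a₃ b F
  · exact typedCount_nonneg_of_hasRootCut ends o a₁ a₂ a₃ b F τ hτ hcut
  · exact hc V E ends o a₁ a₂ a₃ b F τ hτ ⟨hcore, hcut⟩

end Closure

end TypedRed

end CovForm

end Summit.Ventures.PercRepro2
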